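import Summits.SmoothPoincare4.SmoothPoincare4.Theorems.ConvexBisectionAcyclicBisectionExistsPageTubeMap
import Summits.SmoothPoincare4.SmoothPoincare4.Theorems.ConvexBisectionAcyclicBisectionExistsCrossingNumberOrientation
import Literature.Topology.FourManifolds.CircleTubeTransition
import HarnessLib

/-!
# The differential of the page-adapted tube map at the zero section is injective
(wave 3, worker Z4, brick T3c-1 (3b) "page-adapted circle tube", part 3, of stub
`stub_steinRealisation` = NF6 `Literature.Geometry.Symplectic.steinRealisation_of_sorted_modelsOnFibred`,
line `modp-braid-orbits` r11, crux `ConvexBisection.AcyclicBisectionExists`, item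
stmt-SmoothPoincare4-10508; registered sub-goal `helper_pageCurve_deriv_independent`)

Sequel of `…PageTubeMap.lean` (the tube map `tubeAmb θ Θ K m (ψ, v) = θ (v₁, (Θ (v₀, (K ψ, m ψ))).1)` of
a page curve `K`, `θ` the page-rotation flow, `Θ` the in-page flow).  Here:

* §2 the differential of the tube map at the zero section (`mfderiv_tubeAmb_zero_apply`): along the
  two fibre directions it is the in-page field and the page-rotation field (the flow equations, read
  as line derivatives of the smooth core `tubeCore`), along the circle it is `dK`
  (`mfderiv_prod_eq_add_apply`);
* §3 the registered sub-goal `helper_pageCurve_deriv_independent` — **at a point of a smoothly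
  embedded page curve `K`, the vectors `dK ξ`, a non-zero real multiple of the in-page normal `i K'`
  and any vector `rot` with `dw(rot) = i w` are linearly independent**: `dK ξ` and `i K'` lie in the
  complex tangent line of the page, killed by `dw`, and `w ≠ 0` on a page; `dK ξ ∈ ℝ K'` is
  orthogonal to `i K'`; `K' ≠ 0` for an embedding (`knotVelocity_ne_zero`) — whence
  `injective_mfderiv_tubeAmb_zero`: the differential of the tube map of `K` at the zero section is
  injective (its fibre columns being `C⁻¹ · i K'` and the rotation field, `dw = i w` there).

Everything is proved; no named facts, no `sorry`.  References: A. A. Kosinski, *Differential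
Manifolds* (1993), III (3.1) [Kosinski1993]; J. B. Etnyre, T. Fuller, *Realizing 4-manifolds as
achiral Lefschetz fibrations*, IMRN 2006, §2 (page framing `(i K', n)`) [EtnyreFuller2006].
-/

noncomputable section

set_option linter.dupNamespace false

open scoped Manifold ContDiff Topology ComplexConjugate
open Set Function Metric Filter
open Literature.Topology.FourManifolds Literature.Topology.FourManifolds.LefschetzBase
open Literature.Geometry.Symplectic

namespace Summit.SmoothPoincare4.SmoothPoincare4.Theorems.AcyclicBisectionExists.ModpBraidOrbits

variable {g : ℕ}

/-! ## §2 The differential of the tube map at the zero section -/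

section Deriv

variable {δ : ℝ} {θ : ℝ × EuclideanSpace ℝ (Fin 4) → EuclideanSpace ℝ (Fin 4)}
  {Θ : ℝ × (EuclideanSpace ℝ (Fin 4) × ℂ) → EuclideanSpace ℝ (Fin 4) × ℂ}
  (hθ : ContDiff ℝ ∞ θ) (h0θ : ∀ x, θ (0, x) = x)
  (hderθ : ∀ x t, HasDerivAt (fun t => θ (t, x)) (rotFieldA g (fun _ => (1 : ℝ)) (θ (t, x))) t)
  (hΘ : ContDiff ℝ ∞ Θ) (h0Θ : ∀ z, Θ (0, z) = z)
  (hderΘ : ∀ z t, HasDerivAt (fun t => Θ (t, z)) (pageFieldP g δ (Θ (t, z))) t)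

/-- **The core of the tube map**: `(v, z) ↦ θ (v₁, (Θ (v₀, z)).1)` on `ℝ² × (ℝ⁴ × ℂ)`, so that
`tubeAmb θ Θ K m (ψ, v) = tubeCore θ Θ (v, (K ψ, m ψ))`. [folklore] -/
def tubeCore (θ : ℝ × EuclideanSpace ℝ (Fin 4) → EuclideanSpace ℝ (Fin 4))
    (Θ : ℝ × (EuclideanSpace ℝ (Fin 4) × ℂ) → EuclideanSpace ℝ (Fin 4) × ℂ)
    (p : EuclideanSpace ℝ (Fin 2) × (EuclideanSpace ℝ (Fin 4) × ℂ)) : EuclideanSpace ℝ (Fin 4) :=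
  θ (p.1 1, (Θ (p.1 0, p.2)).1)

/-- The tube map is the core evaluated at `(v, (K ψ, m ψ))`. [folklore] -/
theorem tubeAmb_eq_tubeCore (K : sphere (0 : EuclideanSpace ℝ (Fin 2)) 1 → Base g)
    (m : sphere (0 : EuclideanSpace ℝ (Fin 2)) 1 → ℂ)
    (q : sphere (0 : EuclideanSpace ℝ (Fin 2)) 1 × EuclideanSpace ℝ (Fin 2)) :
    tubeAmb θ Θ K m q = tubeCore θ Θ (q.2, ((K q.1).1, m q.1)) := rfl

include hθ hΘ in
/-- The core is smooth. [folklore] -/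
theorem contDiff_tubeCore : ContDiff ℝ ∞ (tubeCore θ Θ) := by
  have h0 : ContDiff ℝ ∞ fun p : EuclideanSpace ℝ (Fin 2) × (EuclideanSpace ℝ (Fin 4) × ℂ) =>
      (p.1 0, p.2) :=
    ((EuclideanSpace.proj (𝕜 := ℝ) (0 : Fin 2)).contDiff.comp contDiff_fst).prodMk contDiff_snd
  have h1 : ContDiff ℝ ∞ fun p : EuclideanSpace ℝ (Fin 2) × (EuclideanSpace ℝ (Fin 4) × ℂ) =>
      (p.1 1, (Θ (p.1 0, p.2)).1) :=
    ((EuclideanSpace.proj (𝕜 := ℝ) (1 : Fin 2)).contDiff.comp contDiff_fst).prodMk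
      (contDiff_fst.comp (hΘ.comp h0))
  exact hθ.comp h1

variable (z₀ : EuclideanSpace ℝ (Fin 4) × ℂ)

include hθ hΘ in
/-- A directional derivative of the (differentiable) core is computed along the line.
[folklore] -/
theorem fderiv_tubeCore_eq_of_line (d : EuclideanSpace ℝ (Fin 2) × (EuclideanSpace ℝ (Fin 4) × ℂ))
    {F : ℝ → EuclideanSpace ℝ (Fin 4)} {f' : EuclideanSpace ℝ (Fin 4)}
    (heq : (fun s : ℝ => tubeCore θ Θ (((0 : EuclideanSpace ℝ (Fin 2)), z₀) + s • d)) = F)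
    (hF : HasDerivAt F f' 0) :
    fderiv ℝ (tubeCore θ Θ) ((0 : EuclideanSpace ℝ (Fin 2)), z₀) d = f' := by
  have hd := ((contDiff_tubeCore hθ hΘ).differentiable (by simp)) ((0 : EuclideanSpace ℝ (Fin 2)), z₀)
  have hline : HasDerivAt (fun s : ℝ => tubeCore θ Θ (((0 : EuclideanSpace ℝ (Fin 2)), z₀) + s • d))
      (fderiv ℝ (tubeCore θ Θ) ((0 : EuclideanSpace ℝ (Fin 2)), z₀) d) 0 :=
    hd.hasFDerivAt.hasLineDerivAt _
  rw [heq] at hline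
  exact hline.unique hF

include hθ hΘ h0θ h0Θ in
/-- Along the base point the core is the first projection: `d(tubeCore)(0, ζ) = ζ.1`. [folklore] -/
theorem fderiv_tubeCore_inr (ζ : EuclideanSpace ℝ (Fin 4) × ℂ) :
    fderiv ℝ (tubeCore θ Θ) ((0 : EuclideanSpace ℝ (Fin 2)), z₀) ((0 : EuclideanSpace ℝ (Fin 2)), ζ) =
      ζ.1 := by
  refine fderiv_tubeCore_eq_of_line hθ hΘ z₀ _ (F := fun s : ℝ => z₀.1 + s • ζ.1) (funext fun s => ?_) ?_
  · simp only [tubeCore, Prod.smul_mk, smul_zero, Prod.mk_add_mk, add_zero, PiLp.zero_apply, h0Θ,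
      h0θ, Prod.fst_add, Prod.smul_fst]
  · have h := ((hasDerivAt_id (0 : ℝ)).smul_const ζ.1).const_add z₀.1
    rwa [one_smul] at h

include hθ hΘ h0θ h0Θ hderθ in
/-- In the second fibre direction the core moves by the page-rotation flow:
`d(tubeCore)(e₁, 0) = rotFieldA (z₀.1)`. [folklore] -/
theorem fderiv_tubeCore_e1 :
    fderiv ℝ (tubeCore θ Θ) ((0 : EuclideanSpace ℝ (Fin 2)), z₀)
      (planeE1, (0 : EuclideanSpace ℝ (Fin 4) × ℂ)) = rotFieldA g (fun _ => (1 : ℝ)) z₀.1 := by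
  refine fderiv_tubeCore_eq_of_line hθ hΘ z₀ _ (F := fun s : ℝ => θ (s, z₀.1)) (funext fun s => ?_) ?_
  · simp only [tubeCore, Prod.smul_mk, smul_zero, Prod.mk_add_mk, add_zero, zero_add, PiLp.smul_apply,
      planeE1_apply_one, planeE1_apply_zero, smul_eq_mul, mul_one, mul_zero, h0Θ]
  · have h := hderθ z₀.1 0
    rwa [h0θ] at h

include hθ hΘ h0θ h0Θ hderΘ in
/-- In the first fibre direction the core moves by the in-page flow:
`d(tubeCore)(e₀, 0) = (pageFieldP z₀).1`. [folklore] -/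
theorem fderiv_tubeCore_e0 :
    fderiv ℝ (tubeCore θ Θ) ((0 : EuclideanSpace ℝ (Fin 2)), z₀)
      (planeE0, (0 : EuclideanSpace ℝ (Fin 4) × ℂ)) = (pageFieldP g δ z₀).1 := by
  refine fderiv_tubeCore_eq_of_line hθ hΘ z₀ _ (F := fun s : ℝ => (Θ (s, z₀)).1) (funext fun s => ?_) ?_
  · simp only [tubeCore, Prod.smul_mk, smul_zero, Prod.mk_add_mk, add_zero, zero_add, PiLp.smul_apply,
      planeE0_apply_one, planeE0_apply_zero, smul_eq_mul, mul_one, mul_zero, h0θ]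
  · have h := hasDerivAt_fst_pageFlowline (hderΘ z₀) 0
    rwa [h0Θ] at h

include hθ hΘ h0θ h0Θ hderθ hderΘ in
/-- **The differential of the core at a base point**:
`d(tubeCore)_{(0, z₀)} (v, ζ) = ζ.1 + v₀ · (pageFieldP z₀).1 + v₁ · rotFieldA (z₀.1)`. [folklore] -/
theorem fderiv_tubeCore_apply (v : EuclideanSpace ℝ (Fin 2)) (ζ : EuclideanSpace ℝ (Fin 4) × ℂ) :
    fderiv ℝ (tubeCore θ Θ) ((0 : EuclideanSpace ℝ (Fin 2)), z₀) (v, ζ) =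
      ζ.1 + v 0 • (pageFieldP g δ z₀).1 + v 1 • rotFieldA g (fun _ => (1 : ℝ)) z₀.1 := by
  have hsplit : ((v, ζ) : EuclideanSpace ℝ (Fin 2) × (EuclideanSpace ℝ (Fin 4) × ℂ)) =
      ((0 : EuclideanSpace ℝ (Fin 2)), ζ) + v 0 • (planeE0, (0 : EuclideanSpace ℝ (Fin 4) × ℂ)) +
        v 1 • (planeE1, (0 : EuclideanSpace ℝ (Fin 4) × ℂ)) := by
    ext1
    · simp only [Prod.fst_add, Prod.smul_fst, zero_add]
      exact plane_eq_smul_add_smul v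
    · simp only [Prod.snd_add, Prod.smul_snd, smul_zero, add_zero]
  rw [hsplit, map_add, map_add, map_smul, map_smul, fderiv_tubeCore_inr hθ h0θ hΘ h0Θ,
    fderiv_tubeCore_e0 hθ h0θ hΘ h0Θ hderΘ, fderiv_tubeCore_e1 hθ h0θ hderθ hΘ h0Θ]

variable {K : sphere (0 : EuclideanSpace ℝ (Fin 2)) 1 → Base g} {m : sphere (0 : EuclideanSpace ℝ (Fin 2)) 1 → ℂ}
  (hK : ContMDiff (𝓡 1) (𝓡∂ 4) ∞ K) (hm : ContMDiff (𝓡 1) 𝓘(ℝ, ℂ) ∞ m)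

include hθ hΘ h0θ h0Θ hderθ hderΘ hK hm in
/-- **The differential of the tube map at the zero section**: for `ξ ∈ T_ψ 𝕊¹` and `v ∈ ℝ²`,
`d(tubeAmb)_{(ψ, 0)} (ξ, v) = v₀ · (pageFieldP (K ψ, m ψ)).1 + v₁ · rotFieldA (K ψ) + dK_ψ ξ`
(the splitting `mfderiv_prod_eq_add_apply` of the differential on a product; along the circle the
tube map is `K`, along the fibre it is the core; `@id` retypes the tangent vector in `ℝ⁴`). [folklore] -/
theorem mfderiv_tubeAmb_zero_apply (ψ : sphere (0 : EuclideanSpace ℝ (Fin 2)) 1)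
    (ξ : EuclideanSpace ℝ (Fin 1)) (v : EuclideanSpace ℝ (Fin 2)) :
    mfderiv ((𝓡 1).prod 𝓘(ℝ, EuclideanSpace ℝ (Fin 2))) 𝓘(ℝ, EuclideanSpace ℝ (Fin 4))
        (tubeAmb θ Θ K m) (ψ, 0) (ξ, v) =
      v 0 • (pageFieldP g δ ((K ψ).1, m ψ)).1 + v 1 • rotFieldA g (fun _ => (1 : ℝ)) (K ψ).1 +
        @id (EuclideanSpace ℝ (Fin 4))
          (mfderiv (𝓡 1) 𝓘(ℝ, EuclideanSpace ℝ (Fin 4)) (fun ψ => (K ψ).1) ψ ξ) := by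
  have hdiff : MDifferentiableAt ((𝓡 1).prod 𝓘(ℝ, EuclideanSpace ℝ (Fin 2)))
      𝓘(ℝ, EuclideanSpace ℝ (Fin 4)) (tubeAmb θ Θ K m) (ψ, 0) :=
    (contMDiff_tubeAmb hθ hΘ hK hm).mdifferentiableAt (by simp)
  rw [mfderiv_prod_eq_add_apply hdiff]
  -- along the circle: the tube map is `K`
  have h1 : (fun x : sphere (0 : EuclideanSpace ℝ (Fin 2)) 1 =>
      tubeAmb θ Θ K m (x, ((ψ, (0 : EuclideanSpace ℝ (Fin 2))) :
        sphere (0 : EuclideanSpace ℝ (Fin 2)) 1 × EuclideanSpace ℝ (Fin 2)).2)) = fun x => (K x).1 :=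
    funext fun x => tubeAmb_zero h0Θ h0θ x
  -- along the fibre: the core at `(K ψ, m ψ)`
  have h2 : (fun y : EuclideanSpace ℝ (Fin 2) =>
      tubeAmb θ Θ K m (((ψ, (0 : EuclideanSpace ℝ (Fin 2))) :
        sphere (0 : EuclideanSpace ℝ (Fin 2)) 1 × EuclideanSpace ℝ (Fin 2)).1, y)) =
      tubeCore θ Θ ∘ fun y => (y, ((K ψ).1, m ψ)) := rfl
  have h3 : HasFDerivAt (tubeCore θ Θ ∘ fun y : EuclideanSpace ℝ (Fin 2) => (y, ((K ψ).1, m ψ)))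
      ((fderiv ℝ (tubeCore θ Θ) ((0 : EuclideanSpace ℝ (Fin 2)), ((K ψ).1, m ψ))).comp
        (ContinuousLinearMap.inl ℝ (EuclideanSpace ℝ (Fin 2)) (EuclideanSpace ℝ (Fin 4) × ℂ)))
      0 :=
    (((contDiff_tubeCore hθ hΘ).differentiable (by simp)) _).hasFDerivAt.comp 0 (hasFDerivAt_prodMk_left _ _)
  rw [h1, h2, h3.hasMFDerivAt.mfderiv]
  show _ + fderiv ℝ (tubeCore θ Θ) ((0 : EuclideanSpace ℝ (Fin 2)), ((K ψ).1, m ψ)) (v, 0) = _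
  rw [fderiv_tubeCore_apply hθ h0θ hderθ hΘ h0Θ hderΘ, Prod.fst_zero, zero_add]
  exact add_comm _ _

end Deriv

/-! ## §3 The differential is injective: the tube map is a local diffeomorphism at the zero section -/

/-- `⟪i T, i T⟫ = ‖T‖²`. [folklore] -/
theorem inner_cplxJ_cplxJ (T : EuclideanSpace ℝ (Fin 4)) : inner ℝ (cplxJ T) (cplxJ T) = ‖T‖ ^ 2 := by
  have h : cx (cplxJ T) * conj (cx T) + cy (cplxJ T) * conj (cy T) =
      Complex.I * ((‖cx T‖ ^ 2 + ‖cy T‖ ^ 2 : ℝ) : ℂ) := by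
    rw [cx_cplxJ, cy_cplxJ]
    push_cast
    rw [← Complex.mul_conj', ← Complex.mul_conj']
    ring
  rw [inner_cplxJ, h, Complex.I_mul_im, Complex.ofReal_re, norm_sq_eq]

section Inj

variable {c : ℂ} {K : sphere (0 : EuclideanSpace ℝ (Fin 2)) 1 → Base g}

/-- Tangent vectors of a page curve, read in `ℝ⁴`, are killed by `dw` (`w ∘ K` is constant).
[folklore] -/
theorem fderiv_w_mfderiv_eq_zero (hK : ContMDiff (𝓡 1) (𝓡∂ 4) ∞ K) (hKc : ∀ θ, K θ ∈ page g c)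
    (ψ : sphere (0 : EuclideanSpace ℝ (Fin 2)) 1) (ξ : EuclideanSpace ℝ (Fin 1)) :
    fderiv ℝ (w g) (K ψ).1
      (@id (EuclideanSpace ℝ (Fin 4))
        (mfderiv (𝓡 1) 𝓘(ℝ, EuclideanSpace ℝ (Fin 4)) (fun ψ => (K ψ).1) ψ ξ)) = 0 := by
  have hK₄ : ContMDiff (𝓡 1) 𝓘(ℝ, EuclideanSpace ℝ (Fin 4)) ∞ fun ψ => (K ψ).1 :=
    (RegularSublevel.contMDiff_incl (isRegularLevel_rho g)).comp hK
  have hwd : HasFDerivAt (w g) (fderiv ℝ (w g) (K ψ).1) (K ψ).1 :=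
    (((contDiff_w g).differentiable (by simp)) _).hasFDerivAt
  have hcomp : HasMFDerivAt (𝓡 1) 𝓘(ℝ, ℂ) (w g ∘ fun ψ => (K ψ).1) ψ
      ((fderiv ℝ (w g) (K ψ).1).comp
        (mfderiv (𝓡 1) 𝓘(ℝ, EuclideanSpace ℝ (Fin 4)) (fun ψ => (K ψ).1) ψ)) :=
    hwd.hasMFDerivAt.comp ψ (hK₄.mdifferentiableAt (by simp)).hasMFDerivAt
  have hconst : (w g ∘ fun ψ => (K ψ).1) = fun _ => c / 2 := funext fun ψ => (hKc ψ).2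
  have hzero : HasMFDerivAt (𝓡 1) 𝓘(ℝ, ℂ) (w g ∘ fun ψ => (K ψ).1) ψ
      (0 : EuclideanSpace ℝ (Fin 1) →L[ℝ] ℂ) := by
    rw [hconst]
    exact hasMFDerivAt_const _ _
  have h := hcomp.mfderiv.symm.trans hzero.mfderiv
  exact congrArg (fun L : EuclideanSpace ℝ (Fin 1) →L[ℝ] ℂ => L ξ) h

/-- **Linear independence at a point of a page curve** (registered sub-goal
`helper_pageCurve_deriv_independent` of NF6, brick T3c-1 (3b)).  Let `K : 𝕊¹ → Base g` be a smooth
embedding into the page `page g c` (`‖c‖ = 1`) and `ψ = e^{2πit}`; let `pf` be a non-zero real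
multiple of the in-page normal `i K'(t)` killed by `dw`, and `rot` a vector with `dw(rot) = i w`
(in `ℝ⁴`, at `K ψ`).  Then `v₀ · pf + v₁ · rot + dK_ψ ξ = 0` forces `ξ = 0` and `v = 0`: apply `dw`
(`v₁ = 0`: `dK ξ` and `pf` are `ℂ`-tangent to the page `{w = c/2}` and `w ≠ 0`), pair with `i K'`
(`v₀ = 0`: `dK ξ ∈ ℝ · K'` and `⟪K', iK'⟫ = 0`, `inner_cplxJ_self`), and use `K' ≠ 0` (`ξ = 0`).  This is the pointwise
content of "the page-adapted tube map is an immersion along its core"; `dK ξ` is retyped in `ℝ⁴` by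
`@id`. [cite: Kosinski1993, III (3.1)] -/
theorem helper_pageCurve_deriv_independent : ∀ (g : ℕ) (c : ℂ)
    (K : Metric.sphere (0 : EuclideanSpace ℝ (Fin 2)) 1 →
      Literature.Topology.FourManifolds.LefschetzBase.Base g)
    (t r : ℝ) (pf rot : EuclideanSpace ℝ (Fin 4)) (ξ : EuclideanSpace ℝ (Fin 1)) (v : EuclideanSpace ℝ (Fin 2)),
    ‖c‖ = 1 → Manifold.IsSmoothEmbedding (𝓡 1) (𝓡∂ 4) ∞ K →
    (∀ θ, K θ ∈ Literature.Topology.FourManifolds.LefschetzBase.page g c) → r ≠ 0 →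
    pf = r • Literature.Topology.FourManifolds.LefschetzBase.cplxJ
      (deriv (Literature.Topology.FourManifolds.LefschetzBase.ambCurve g K) t) →
    fderiv ℝ (Literature.Topology.FourManifolds.LefschetzBase.w g)
      (K (Literature.Topology.FourManifolds.circlePt t)).1 pf = 0 →
    fderiv ℝ (Literature.Topology.FourManifolds.LefschetzBase.w g)
      (K (Literature.Topology.FourManifolds.circlePt t)).1 rot =
        Complex.I * Literature.Topology.FourManifolds.LefschetzBase.w g
          (K (Literature.Topology.FourManifolds.circlePt t)).1 →
    v 0 • pf + v 1 • rot + @id (EuclideanSpace ℝ (Fin 4))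
      (mfderiv (𝓡 1) 𝓘(ℝ, EuclideanSpace ℝ (Fin 4)) (fun ψ => (K ψ).1)
        (Literature.Topology.FourManifolds.circlePt t) ξ) = 0 →
    ξ = 0 ∧ v = 0 := by
  intro g c K t r pf rot ξ v hc hK hKc hr hpf hpfw hrot h
  have hK₄ : ContMDiff (𝓡 1) 𝓘(ℝ, EuclideanSpace ℝ (Fin 4)) ∞ fun ψ => (K ψ).1 :=
    (RegularSublevel.contMDiff_incl (isRegularLevel_rho g)).comp hK.contMDiff
  set T : EuclideanSpace ℝ (Fin 4) := deriv (ambCurve g K) t with hT_def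
  -- `w ≠ 0` on the page, `K' ≠ 0`
  have hw : w g (K (circlePt t)).1 ≠ 0 := by
    rw [(hKc _).2]
    intro h0
    have : c = 0 := by linear_combination 2 * h0
    rw [this, norm_zero] at hc
    exact zero_ne_one hc
  have hKd : MDifferentiableAt (𝓡 1) (𝓡∂ 4) K (circlePt t) := hK.contMDiff.mdifferentiableAt (by simp)
  have hT : T ≠ 0 := by
    rw [hT_def, deriv_ambCurve hKd]
    intro h0
    exact knotVelocity_ne_zero hK t (injective_ambient _ (h0.trans (map_zero _).symm))
  -- step 1: `v 1 = 0`
  have h1 : v 1 = 0 := by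
    have h' := congrArg (fderiv ℝ (w g) (K (circlePt t)).1) h
    rw [map_add, map_add, map_smul, map_smul, hpfw, hrot, fderiv_w_mfderiv_eq_zero hK.contMDiff hKc,
      map_zero, smul_zero, zero_add, add_zero] at h'
    rcases smul_eq_zero.1 h' with h' | h'
    · exact h'
    · exact absurd h' (mul_ne_zero Complex.I_ne_zero hw)
  rw [h1, zero_smul, add_zero] at h
  -- step 2: `ξ = s • D1` and `dK (D1) = K'`
  set D1 : EuclideanSpace ℝ (Fin 1) := mfderiv 𝓘(ℝ, ℝ) (𝓡 1) circlePt t 1 with hD1_def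
  have hD1 : D1 ≠ 0 := fun h0 =>
    (one_ne_zero (α := ℝ)) ((mfderiv_circlePt_injective t) (h0.trans (map_zero _).symm))
  obtain ⟨s, hs⟩ := (finrank_eq_one_iff_of_nonzero' D1 hD1).1 finrank_euclideanSpace_fin ξ
  have hDT : @id (EuclideanSpace ℝ (Fin 4))
      (mfderiv (𝓡 1) 𝓘(ℝ, EuclideanSpace ℝ (Fin 4)) (fun ψ => (K ψ).1) (circlePt t) D1) = T := by
    have hcomp := mfderiv_comp t (hK₄.mdifferentiableAt (x := circlePt t) (by simp))
      (contMDiff_circlePt.mdifferentiableAt (by simp))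
    have key := (DFunLike.congr_fun hcomp (1 : ℝ)).symm
    rw [mfderiv_eq_fderiv] at key
    exact key
  have hξT : @id (EuclideanSpace ℝ (Fin 4))
      (mfderiv (𝓡 1) 𝓘(ℝ, EuclideanSpace ℝ (Fin 4)) (fun ψ => (K ψ).1) (circlePt t) ξ) = s • T := by
    rw [← hs, ← hDT]
    exact (mfderiv (𝓡 1) 𝓘(ℝ, EuclideanSpace ℝ (Fin 4)) (fun ψ => (K ψ).1) (circlePt t)).map_smul s D1
  rw [hξT, hpf, smul_smul] at h
  -- step 3: pair with `i K'`: `v 0 = 0`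
  have h0 : v 0 = 0 := by
    have h' := congrArg (fun V => inner ℝ V (cplxJ T)) h
    simp only [inner_add_left, inner_smul_left, inner_cplxJ_cplxJ, inner_cplxJ_self, mul_zero, add_zero,
      inner_zero_left, RCLike.conj_to_real] at h'
    rcases mul_eq_zero.1 h' with h' | h'
    · rcases mul_eq_zero.1 h' with h' | h'
      · exact h'
      · exact absurd h' hr
    · exact absurd h' (pow_ne_zero 2 (norm_ne_zero_iff.2 hT))
  rw [h0, zero_mul, zero_smul, zero_add] at h
  -- step 4: `s = 0`
  have hs0 : s = 0 := by
    rcases smul_eq_zero.1 h with h | h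
    · exact h
    · exact absurd h hT
  refine ⟨by rw [← hs, hs0, zero_smul], ?_⟩
  ext i
  fin_cases i
  · exact h0
  · exact h1

end Inj

section LocalDiffeo

variable {δ C : ℝ} {c : ℂ} {θ : ℝ × EuclideanSpace ℝ (Fin 4) → EuclideanSpace ℝ (Fin 4)}
  {Θ : ℝ × (EuclideanSpace ℝ (Fin 4) × ℂ) → EuclideanSpace ℝ (Fin 4) × ℂ}
  {K : sphere (0 : EuclideanSpace ℝ (Fin 2)) 1 → Base g}
  (hθ : ContDiff ℝ ∞ θ) (h0θ : ∀ x, θ (0, x) = x)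
  (hderθ : ∀ x t, HasDerivAt (fun t => θ (t, x)) (rotFieldA g (fun _ => (1 : ℝ)) (θ (t, x))) t)
  (hΘ : ContDiff ℝ ∞ Θ) (h0Θ : ∀ z, Θ (0, z) = z)
  (hderΘ : ∀ z t, HasDerivAt (fun t => Θ (t, z)) (pageFieldP g δ (Θ (t, z))) t)
  (hc : ‖c‖ = 1) (hK : Manifold.IsSmoothEmbedding (𝓡 1) (𝓡∂ 4) ∞ K) (hKc : ∀ θ, K θ ∈ page g c)
  (hδ : 0 < δ) (hδK : ∀ ψ, ‖cx (K ψ).1‖ ^ 2 ≤ 4 - δ) (hC : 0 < C) (hCK : ∀ ψ, ‖mPar g K C ψ‖ ≤ 1)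

include hθ h0θ hderθ hΘ h0Θ hderΘ hc hK hKc hδ hδK hC hCK in
/-- **The differential of the tube map at the zero section is injective** (its fibre columns are
`C⁻¹ · i K'` and the rotation field, its circle column is `dK`). [folklore] -/
theorem injective_mfderiv_tubeAmb_zero (ψ : sphere (0 : EuclideanSpace ℝ (Fin 2)) 1) :
    Injective (mfderiv ((𝓡 1).prod 𝓘(ℝ, EuclideanSpace ℝ (Fin 2))) 𝓘(ℝ, EuclideanSpace ℝ (Fin 4))
      (tubeAmb θ Θ K (mPar g K C)) (ψ, 0)) := by
  obtain ⟨t, rfl⟩ : ∃ t, circlePt t = ψ := ⟨angA ψ, circlePt_angA ψ⟩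
  have hρ : rho g (K (circlePt t)).1 = 1 / 4 := rho_eq_of_mem_page g hc (hKc _)
  set z : EuclideanSpace ℝ (Fin 4) × ℂ := ((K (circlePt t)).1, mPar g K C (circlePt t)) with hz
  have hcut : tubeCut g δ z = 1 := by
    rw [tubeCut, cutA_of_le (by rw [hρ]; norm_num), flatCut_of_le hδ (hδK _), parCut_of_le (hCK _),
      one_mul, one_mul]
  have hpf : (pageFieldP g δ z).1 = C⁻¹ • cplxJ (deriv (ambCurve g K) t) := by
    rw [pageFieldP_fst, hcut, one_smul]
    exact kerVec_mPar hK.contMDiff hKc C t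
  have hrot : fderiv ℝ (w g) (K (circlePt t)).1 (rotFieldA g (fun _ => (1 : ℝ)) (K (circlePt t)).1) =
      Complex.I * w g (K (circlePt t)).1 := by
    rw [fderiv_w_rotFieldA_of_le (by rw [hρ]; norm_num), Complex.ofReal_one, one_mul]
  refine (injective_iff_map_eq_zero _).2 fun ξv h => ?_
  obtain ⟨ξ, v⟩ := ξv
  rw [mfderiv_tubeAmb_zero_apply hθ h0θ hderθ hΘ h0Θ hderΘ hK.contMDiff (contMDiff_mPar hK.contMDiff C)]
    at h
  obtain ⟨hξ, hv⟩ := helper_pageCurve_deriv_independent g c K t _ _ _ ξ v hc hK hKc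
    (inv_ne_zero hC.ne') hpf (fderiv_w_pageFieldP z) hrot h
  rw [hξ, hv]
  rfl

end LocalDiffeo

end Summit.SmoothPoincare4.SmoothPoincare4.Theorems.AcyclicBisectionExists.ModpBraidOrbits
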